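import Summits.KontsevichZagierPeriods.KontsevichZagierPeriods.Theorems.TerasomaMultiplicationBetaCancellationStubTameFormAux9
import Summits.KontsevichZagierPeriods.KontsevichZagierPeriods.Theorems.TerasomaMultiplicationBetaCancellationStubTameFormAux10

/-!
# `BetaCancellation` (stmt-KontsevichZagierPeriods-13633), line `divisor-slicing-transshipment` — stub `stub_tameForm`, auxiliary file 11: splitting a positive integrand

**The core of rule (1b).** For `ℚ`-semialgebraic `g₁, g₂ > 0` on a `ℚ`-semialgebraic `P ⊆ ℝⁿ` and
`g = g₁ + g₂` on `P`, the stabilised measured set `(P × (0,1), g)` is `MIso`-isomorphic to the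
disjoint union `(P × (0,1), g₁) ⊔ (P × (0,1), g₂)`: over the open `ℚ`-semialgebraic `G ⊆ P` where
`g₁`, `g₂` are smooth (null complement, `KZ.exists_isOpen_contDiffOn`) cut the fibre `(0,1)` at
`q = g₁/(g₁+g₂)` and stretch the two parts affinely onto `(0,1)` (`exists_affinePiece`; Jacobians
`(g₁+g₂)/g₁`, `(g₁+g₂)/g₂`). Consequently `[R] − [R₁] − [R₂]` has vanishing `K₀`-shadow whenever the
three representations have a common domain, `R₁`, `R₂` have positive integrands and
`R.integrand = R₁.integrand + R₂.integrand` there.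

References: M. Kontsevich, D. Zagier, *Periods* (2001), §1.2 rule (1); crux NOTES c6 (F13).
-/

noncomputable section

-- `Summit.KontsevichZagierPeriods.KontsevichZagierPeriods.…` is the tree's mandated layout (single-conjunct summit).
set_option linter.dupNamespace false

namespace Summit.KontsevichZagierPeriods.KontsevichZagierPeriods.BetaCancellationDivisorSlicing

open MeasureTheory Set Function Filter
open scoped Topology
open Literature.NumberTheory.Transcendental
open Literature.NumberTheory.Transcendental.KZ
open Literature.ModelTheory.ExponentialFields (IsSemialgebraic isSemialgebraic_univ)

variable {n : ℕ}

/-- Membership in a once-lifted set: `init z ∈ s` and `z_last ∈ (0,1)`. [folklore] -/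
theorem mem_liftSet_succ {s : Set (Fin n → ℝ)} {z : Fin (n + 1) → ℝ} :
    z ∈ liftSet (n + 1) s ↔ Fin.init z ∈ s ∧ z (Fin.last n) ∈ Ioo (0 : ℝ) 1 := by
  rw [liftSet_eq n.le_succ, mem_stabSet_succ]

/-- A once-lifted function is the function of `init`. [folklore] -/
theorem liftFun_succ_apply (f : (Fin n → ℝ) → ℝ) (z : Fin (n + 1) → ℝ) :
    liftFun (n + 1) f z = f (Fin.init z) := by
  rw [liftFun_eq n.le_succ]
  rfl

/-- **Splitting a positive integrand** (the core of rule (1b)): for `g₁, g₂ > 0` `ℚ`-semialgebraic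
on `P` and `g = g₁ + g₂` on `P`, `(P × (0,1), g) ≅ (P × (0,1), g₁) ⊔ (P × (0,1), g₂)`.
[cite: KontsevichZagier2001, §1.2 rule (1)] -/
theorem MIso.integrandSplit {P : Set (Fin n → ℝ)} (hP : IsSemialgebraic ℚ P)
    {g g₁ g₂ : (Fin n → ℝ) → ℝ} (hg₁ : IsSemialgebraicFunOn ℚ P g₁) (hg₂ : IsSemialgebraicFunOn ℚ P g₂)
    (h₁ : ∀ x ∈ P, 0 < g₁ x) (h₂ : ∀ x ∈ P, 0 < g₂ x) (hsum : ∀ x ∈ P, g x = g₁ x + g₂ x) :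
    Nonempty (MIso (n + 1) (fun _ : Unit => {z : Fin (n + 1) → ℝ | Fin.init z ∈ P ∧
        z (Fin.last n) ∈ Ioo (0 : ℝ) 1}) (fun _ z => g (Fin.init z))
      (fun _ : Fin 2 => {z : Fin (n + 1) → ℝ | Fin.init z ∈ P ∧ z (Fin.last n) ∈ Ioo (0 : ℝ) 1})
      (fun p z => (![g₁, g₂] p) (Fin.init z))) := by
  -- smooth locus
  obtain ⟨G₁, hG₁P, hG₁o, hG₁s, hG₁sm, -, hG₁n⟩ := exists_isOpen_contDiffOn hP hg₁
  obtain ⟨G₂, hG₂P, hG₂o, hG₂s, hG₂sm, -, hG₂n⟩ := exists_isOpen_contDiffOn hP hg₂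
  set G := G₁ ∩ G₂ with hG_def
  have hGP : G ⊆ P := fun y hy => hG₁P hy.1
  have hGo : IsOpen G := hG₁o.inter hG₂o
  have hGs : IsSemialgebraic ℚ G := hG₁s.inter hG₂s
  have hGn : volume (P \ G) = 0 := by
    have : P \ G ⊆ (P \ G₁) ∪ (P \ G₂) := by
      intro y hy
      by_cases h : y ∈ G₁
      · exact Or.inr ⟨hy.1, fun h' => hy.2 ⟨h, h'⟩⟩
      · exact Or.inl ⟨hy.1, h⟩
    exact measure_mono_null this (measure_union_null hG₁n hG₂n)
  have hg₁G : IsSemialgebraicFunOn ℚ G g₁ := hg₁.mono hGP hGs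
  have hg₂G : IsSemialgebraicFunOn ℚ G g₂ := hg₂.mono hGP hGs
  have hd₁ : DifferentiableOn ℝ g₁ G := (hG₁sm.mono inter_subset_left).differentiableOn (by simp)
  have hd₂ : DifferentiableOn ℝ g₂ G := (hG₂sm.mono inter_subset_right).differentiableOn (by simp)
  have hpos₁ : ∀ y ∈ G, 0 < g₁ y := fun y hy => h₁ y (hGP hy)
  have hpos₂ : ∀ y ∈ G, 0 < g₂ y := fun y hy => h₂ y (hGP hy)
  have hne₁ : ∀ y ∈ G, g₁ y ≠ 0 := fun y hy => (hpos₁ y hy).ne'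
  have hne₂ : ∀ y ∈ G, g₂ y ≠ 0 := fun y hy => (hpos₂ y hy).ne'
  have hne : ∀ y ∈ G, g₁ y + g₂ y ≠ 0 := fun y hy => (add_pos (hpos₁ y hy) (hpos₂ y hy)).ne'
  -- the cut point and the two affine pieces
  set q : (Fin n → ℝ) → ℝ := fun y => g₁ y / (g₁ y + g₂ y) with hq
  have hqs : IsSemialgebraicFunOn ℚ G q :=
    hg₁G.div (IsSemialgebraicFunOn.add_holds hg₁G hg₂G) hne
  have hq01 : ∀ y ∈ G, 0 < q y ∧ q y < 1 := fun y hy => by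
    have := hpos₁ y hy; have := hpos₂ y hy
    exact ⟨div_pos (hpos₁ y hy) (add_pos (hpos₁ y hy) (hpos₂ y hy)),
      (div_lt_one (add_pos (hpos₁ y hy) (hpos₂ y hy))).mpr (by linarith)⟩
  have hzero : IsSemialgebraicFunOn ℚ G (fun _ => (0 : ℝ)) := by
    simpa using isSemialgebraicFunOn_aeval hGs (0 : MvPolynomial (Fin n) ℚ)
  have hone : IsSemialgebraicFunOn ℚ G (fun _ => (1 : ℝ)) := by
    simpa using isSemialgebraicFunOn_aeval hGs (1 : MvPolynomial (Fin n) ℚ)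
  -- piece 1: `s ↦ s (g₁+g₂)/g₁` on `0 < s < q`
  set β₁ : (Fin n → ℝ) → ℝ := fun y => (g₁ y + g₂ y) / g₁ y with hβ₁
  have hβ₁s : IsSemialgebraicFunOn ℚ G β₁ := (IsSemialgebraicFunOn.add_holds hg₁G hg₂G).div hg₁G hne₁
  have hdiv : ∀ {u v : (Fin n → ℝ) → ℝ}, DifferentiableOn ℝ u G → DifferentiableOn ℝ v G →
      (∀ y ∈ G, v y ≠ 0) → DifferentiableOn ℝ (fun y => u y / v y) G := fun hu hv h0 =>
    (hu.fun_mul (hv.fun_inv h0)).congr fun y _ => by simp [div_eq_mul_inv]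
  have hβ₁d : DifferentiableOn ℝ β₁ G := hdiv (hd₁.add hd₂) hd₁ hne₁
  have hβ₁p : ∀ y ∈ G, 0 < β₁ y := fun y hy =>
    div_pos (add_pos (hpos₁ y hy) (hpos₂ y hy)) (hpos₁ y hy)
  obtain ⟨Ψ₁', hP₁, hsa₁, hinj₁, hder₁, hdet₁, himg₁⟩ := exists_affinePiece hGo subset_rfl hGs hzero hβ₁s
    (differentiableOn_const (0 : ℝ)) hβ₁d hβ₁p hzero hqs
  -- piece 2: `s ↦ (s - q) (g₁+g₂)/g₂` on `q < s < 1`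
  set β₂ : (Fin n → ℝ) → ℝ := fun y => (g₁ y + g₂ y) / g₂ y with hβ₂
  set α₂ : (Fin n → ℝ) → ℝ := fun y => -(g₁ y / g₂ y) with hα₂
  have hβ₂s : IsSemialgebraicFunOn ℚ G β₂ := (IsSemialgebraicFunOn.add_holds hg₁G hg₂G).div hg₂G hne₂
  have hα₂s : IsSemialgebraicFunOn ℚ G α₂ := (hg₁G.div hg₂G hne₂).neg
  have hβ₂d : DifferentiableOn ℝ β₂ G := hdiv (hd₁.add hd₂) hd₂ hne₂
  have hα₂d : DifferentiableOn ℝ α₂ G := (hdiv hd₁ hd₂ hne₂).neg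
  have hβ₂p : ∀ y ∈ G, 0 < β₂ y := fun y hy =>
    div_pos (add_pos (hpos₁ y hy) (hpos₂ y hy)) (hpos₂ y hy)
  obtain ⟨Ψ₂', hP₂, hsa₂, hinj₂, hder₂, hdet₂, himg₂⟩ := exists_affinePiece hGo subset_rfl hGs hα₂s hβ₂s
    hα₂d hβ₂d hβ₂p hqs hone
  -- algebra of the cut
  have hβ₁q : ∀ y ∈ G, (0 : ℝ) + β₁ y * q y = 1 := fun y hy => by
    simp only [hβ₁, hq, zero_add]
    field_simp [hne₁ y hy, hne y hy]
  have hα₂q : ∀ y ∈ G, α₂ y + β₂ y * q y = 0 := fun y hy => by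
    simp only [hα₂, hβ₂, hq]
    field_simp [hne₂ y hy, hne y hy]
    ring
  have hα₂1 : ∀ y ∈ G, α₂ y + β₂ y * 1 = 1 := fun y hy => by
    simp only [hα₂, hβ₂]
    field_simp [hne₂ y hy]
    ring
  -- assemble
  set P₁ := {z : Fin (n + 1) → ℝ | (Fin.init z : Fin n → ℝ) ∈ G ∧ (fun _ => (0 : ℝ)) (Fin.init z) <
    z (Fin.last n) ∧ z (Fin.last n) < q (Fin.init z)} with hP₁_def
  set P₂ := {z : Fin (n + 1) → ℝ | (Fin.init z : Fin n → ℝ) ∈ G ∧ q (Fin.init z) < z (Fin.last n) ∧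
    z (Fin.last n) < (fun _ => (1 : ℝ)) (Fin.init z)} with hP₂_def
  set Ψ₁ : (Fin (n + 1) → ℝ) → (Fin (n + 1) → ℝ) := fun w =>
    Fin.snoc (Fin.init w) ((fun _ => (0 : ℝ)) (Fin.init w) + β₁ (Fin.init w) * w (Fin.last n)) with hΨ₁
  set Ψ₂ : (Fin (n + 1) → ℝ) → (Fin (n + 1) → ℝ) := fun w =>
    Fin.snoc (Fin.init w) (α₂ (Fin.init w) + β₂ (Fin.init w) * w (Fin.last n)) with hΨ₂
  have himg₁' : Ψ₁ '' P₁ = {z : Fin (n + 1) → ℝ | (Fin.init z : Fin n → ℝ) ∈ G ∧ 0 < z (Fin.last n) ∧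
      z (Fin.last n) < 1} := by
    rw [himg₁]
    ext w
    simp only [mem_setOf_eq]
    refine ⟨fun ⟨hw, hwa, hwb⟩ => ⟨hw, by simpa using hwa, by rwa [hβ₁q _ hw] at hwb⟩,
      fun ⟨hw, hwa, hwb⟩ => ⟨hw, by simpa using hwa, by rwa [hβ₁q _ hw]⟩⟩
  have himg₂' : Ψ₂ '' P₂ = {z : Fin (n + 1) → ℝ | (Fin.init z : Fin n → ℝ) ∈ G ∧ 0 < z (Fin.last n) ∧
      z (Fin.last n) < 1} := by
    rw [himg₂]
    ext w
    simp only [mem_setOf_eq]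
    refine ⟨fun ⟨hw, hwa, hwb⟩ => ⟨hw, by rwa [hα₂q _ hw] at hwa, by rwa [hα₂1 _ hw] at hwb⟩,
      fun ⟨hw, hwa, hwb⟩ => ⟨hw, by rwa [hα₂q _ hw], by rwa [hα₂1 _ hw]⟩⟩
  have hcovT : {z : Fin (n + 1) → ℝ | Fin.init z ∈ P ∧ z (Fin.last n) ∈ Ioo (0 : ℝ) 1} \
      {z : Fin (n + 1) → ℝ | (Fin.init z : Fin n → ℝ) ∈ G ∧ 0 < z (Fin.last n) ∧ z (Fin.last n) < 1} ⊆
      {z : Fin (n + 1) → ℝ | Fin.init z ∈ P \ G} := by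
    intro z hz
    exact ⟨hz.1.1, fun hzG => hz.2 ⟨hzG, hz.1.2.1, hz.1.2.2⟩⟩
  refine MIso.of_fintype (P₀ := Unit ⊕ Unit) (fun _ => ()) (Sum.elim (fun _ => 0) (fun _ => 1))
    (Sum.elim (fun _ => P₁) (fun _ => P₂)) (Sum.elim (fun _ => Ψ₁) (fun _ => Ψ₂))
    (Sum.elim (fun _ => Ψ₁') (fun _ => Ψ₂')) ?_ ?_ ?_ ?_ ?_
  · rintro (_ | _)
    · simp only [Sum.elim_inl]
      refine ⟨hP₁, ?_, hsa₁, hinj₁, hder₁, ?_, fun z hz => ?_⟩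
      · rintro z ⟨hz, h0, hzq⟩
        exact ⟨hGP hz, h0, hzq.trans (hq01 _ hz).2⟩
      · rw [himg₁']
        rintro w ⟨hw, hwa, hwb⟩
        exact ⟨hGP hw, hwa, hwb⟩
      · have hzG : Fin.init z ∈ G := hz.1
        simp only [Matrix.cons_val_zero, hΨ₁, Fin.init_snoc]
        rw [hdet₁ z hz, hsum _ (hGP hzG), abs_of_pos (hβ₁p _ hzG)]
        simp only [hβ₁]
        field_simp [hne₁ _ hzG]
    · simp only [Sum.elim_inr]
      refine ⟨hP₂, ?_, hsa₂, hinj₂, hder₂, ?_, fun z hz => ?_⟩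
      · rintro z ⟨hz, hzq, h1⟩
        exact ⟨hGP hz, (hq01 _ hz).1.trans hzq, h1⟩
      · rw [himg₂']
        rintro w ⟨hw, hwa, hwb⟩
        exact ⟨hGP hw, hwa, hwb⟩
      · have hzG : Fin.init z ∈ G := hz.1
        simp only [Matrix.cons_val_one, Matrix.cons_val_fin_one, hΨ₂, Fin.init_snoc]
        rw [hdet₂ z hz, hsum _ (hGP hzG), abs_of_pos (hβ₂p _ hzG)]
        simp only [hβ₂]
        field_simp [hne₂ _ hzG]
  · rintro (_ | _) (_ | _) hne' _
    · exact absurd rfl hne'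
    · refine measure_mono_null (fun z hz => ?_) measure_empty
      simp only [Sum.elim_inl, Sum.elim_inr, mem_inter_iff, hP₁_def, hP₂_def, mem_setOf_eq] at hz
      linarith [hz.1.2.2, hz.2.2.1]
    · refine measure_mono_null (fun z hz => ?_) measure_empty
      simp only [Sum.elim_inl, Sum.elim_inr, mem_inter_iff, hP₁_def, hP₂_def, mem_setOf_eq] at hz
      linarith [hz.1.2.1, hz.2.2.2]
    · exact absurd rfl hne'
  · rintro (_ | _) (_ | _) hne' h
    · exact absurd rfl hne'
    · simp at h
    · simp at h
    · exact absurd rfl hne'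
  · intro _
    -- the source slot minus the two pieces lies over `P ∖ G` or on the graph of `q`
    have hsub : {z : Fin (n + 1) → ℝ | Fin.init z ∈ P ∧ z (Fin.last n) ∈ Ioo (0 : ℝ) 1} \
        (⋃ (p : Unit ⊕ Unit) (_ : (fun _ : Unit ⊕ Unit => ()) p = ()),
          Sum.elim (fun _ => P₁) (fun _ => P₂) p) ⊆
        {z : Fin (n + 1) → ℝ | Fin.init z ∈ P \ G} ∪
          {z : Fin (n + 1) → ℝ | Fin.init z ∈ G ∧ z (Fin.last n) = q (Fin.init z)} := by
      intro z hz
      have hz1 : ¬ z ∈ P₁ := fun h => hz.2 (mem_iUnion₂.mpr ⟨Sum.inl (), rfl, h⟩)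
      have hz2 : ¬ z ∈ P₂ := fun h => hz.2 (mem_iUnion₂.mpr ⟨Sum.inr (), rfl, h⟩)
      by_cases hzG : Fin.init z ∈ G
      · right
        refine ⟨hzG, ?_⟩
        rcases lt_trichotomy (z (Fin.last n)) (q (Fin.init z)) with h | h | h
        · exact absurd ⟨hzG, hz.1.2.1, h⟩ hz1
        · exact h
        · exact absurd ⟨hzG, h, hz.1.2.2⟩ hz2
      · exact Or.inl ⟨hz.1.1, hzG⟩
    exact measure_mono_null hsub (measure_union_null (volume_setOf_init_mem_eq_zero hGn)
      (volume_graph_eq_zero hqs))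
  · intro p
    refine measure_mono_null ?_ (measure_mono_null hcovT (volume_setOf_init_mem_eq_zero hGn))
    refine sdiff_subset_sdiff_right ?_
    fin_cases p
    · intro z hz
      refine mem_iUnion₂.mpr ⟨Sum.inl (), rfl, ?_⟩
      simp only [Sum.elim_inl, himg₁']
      exact hz
    · intro z hz
      refine mem_iUnion₂.mpr ⟨Sum.inr (), rfl, ?_⟩
      simp only [Sum.elim_inr, himg₂']
      exact hz

namespace Shadow

/-- **`[R] − [R₁] − [R₂]` has vanishing shadow when the three representations have a common
domain, `R₁`, `R₂` have positive integrands and `R.integrand = R₁.integrand + R₂.integrand` there**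
(the core of rule (1b): `MIso.integrandSplit`, packaged with the empty negative parts).
[cite: KontsevichZagier2001, §1.2 rule (1)] -/
theorem of_integrandAdd_pos (R R₁ R₂ : IntegralRep n) (hd₁ : R₁.domain = R.domain)
    (hd₂ : R₂.domain = R.domain) (h₁ : ∀ x ∈ R.domain, 0 < R₁.integrand x)
    (h₂ : ∀ x ∈ R.domain, 0 < R₂.integrand x)
    (hsum : EqOn R.integrand (R₁.integrand + R₂.integrand) R.domain) :
    Nonempty (Shadow (of R - of R₁ - of R₂)) := by
  have hg₁ : IsSemialgebraicFunOn ℚ R.domain R₁.integrand := hd₁ ▸ R₁.isSemialgebraicFunOn_integrand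
  have hg₂ : IsSemialgebraicFunOn ℚ R.domain R₂.integrand := hd₂ ▸ R₂.isSemialgebraicFunOn_integrand
  have hpos : ∀ x ∈ R.domain, 0 < R.integrand x := fun x hx => by
    rw [hsum hx]; exact add_pos (h₁ x hx) (h₂ x hx)
  obtain ⟨m₀⟩ := MIso.integrandSplit R.isSemialgebraic_domain hg₁ hg₂ h₁ h₂ (fun x hx => hsum hx)
  have hS : ∀ z : Fin (n + 1) → ℝ, z ∈ {z : Fin (n + 1) → ℝ | Fin.init z ∈ R.domain ∧
      z (Fin.last n) ∈ Ioo (0 : ℝ) 1} ↔ Fin.init z ∈ R.domain ∧ z (Fin.last n) ∈ Ioo (0 : ℝ) 1 :=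
    fun z => Iff.rfl
  refine ⟨⟨1, 2, fun _ => ⟨n, R⟩, ![⟨n, R₁⟩, ⟨n, R₂⟩], by simp [Fin.sum_univ_two, sub_sub], n + 1,
    fun _ => n.le_succ, fun j => by fin_cases j <;> exact n.le_succ, Classical.choice ?_⟩⟩
  refine m₀.merge (fun _ => Sum.inl 0) (fun p => Sum.inl p) (fun _ => ⟨fun z hz => ?_, fun z hz => ?_⟩)
    (fun p => ?_) (fun _ _ h _ => (h (Subsingleton.elim _ _)).elim)
    (fun p p' h hh => (h (Sum.inl_injective hh)).elim) ?_ ?_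
  · simp only [Sum.elim_inl, mem_liftSet_succ, mem_posSet]
    exact ⟨⟨hz.1, hpos _ hz.1⟩, hz.2⟩
  · simp only [Sum.elim_inl, liftFun_succ_apply]
  · fin_cases p
    · refine ⟨fun z hz => ?_, fun z hz => ?_⟩
      · simp only [Fin.zero_eta, Fin.isValue, Sum.elim_inl, Matrix.cons_val_zero, mem_liftSet_succ,
          mem_posSet, hd₁]
        exact ⟨⟨hz.1, h₁ _ hz.1⟩, hz.2⟩
      · simp only [Fin.zero_eta, Fin.isValue, Matrix.cons_val_zero, Sum.elim_inl, liftFun_succ_apply]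
    · refine ⟨fun z hz => ?_, fun z hz => ?_⟩
      · simp only [Fin.mk_one, Fin.isValue, Sum.elim_inl, Matrix.cons_val_one, Matrix.cons_val_zero,
          mem_liftSet_succ, mem_posSet, hd₂]
        exact ⟨⟨hz.1, h₂ _ hz.1⟩, hz.2⟩
      · simp only [Fin.mk_one, Fin.isValue, Matrix.cons_val_one, Matrix.cons_val_zero, Sum.elim_inl,
          liftFun_succ_apply]
  · rintro (i | j)
    · refine measure_mono_null (fun z hz => ?_) measure_empty
      simp only [Set.mem_sdiff, Sum.elim_inl, mem_liftSet_succ, mem_posSet, mem_iUnion, exists_prop,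
        not_exists, not_and] at hz
      exact hz.2 () (by simp [Subsingleton.elim i 0]) ⟨hz.1.1.1, hz.1.2⟩
    · refine measure_mono_null (fun z hz => ?_) measure_empty
      have hz' := hz.1
      fin_cases j
      · simp only [Fin.zero_eta, Fin.isValue, Sum.elim_inr, Matrix.cons_val_zero, mem_liftSet_succ,
          mem_negSet, hd₁] at hz'
        linarith [h₁ _ hz'.1.1, hz'.1.2]
      · simp only [Fin.mk_one, Fin.isValue, Sum.elim_inr, Matrix.cons_val_one, Matrix.cons_val_zero,
          mem_liftSet_succ, mem_negSet, hd₂] at hz'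
        linarith [h₂ _ hz'.1.1, hz'.1.2]
  · rintro (j | i)
    · refine measure_mono_null (fun z hz => ?_) measure_empty
      have hz1 := hz.1
      have hz2 := hz.2
      simp only [mem_iUnion, exists_prop, not_exists, not_and] at hz2
      fin_cases j
      · simp only [Fin.zero_eta, Fin.isValue, Sum.elim_inl, Matrix.cons_val_zero, mem_liftSet_succ,
          mem_posSet, hd₁] at hz1
        exact hz2 0 rfl ⟨hz1.1.1, hz1.2⟩
      · simp only [Fin.mk_one, Fin.isValue, Sum.elim_inl, Matrix.cons_val_one, Matrix.cons_val_zero,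
          mem_liftSet_succ, mem_posSet, hd₂] at hz1
        exact hz2 1 rfl ⟨hz1.1.1, hz1.2⟩
    · refine measure_mono_null (fun z hz => ?_) measure_empty
      have hz' := hz.1
      simp only [Sum.elim_inr, mem_liftSet_succ, mem_negSet] at hz'
      linarith [hpos _ hz'.1.1, hz'.1.2]

end Shadow

/-! ### Headline -/

/-- Registered helper goal of the stub `stub_tameForm`: the positive core of rule (1b) has vanishing
`K₀`-shadow. [cite: KontsevichZagier2001, §1.2 rule (1)] -/
theorem tameForm_aux_shadowSplitPos : ∀ {n : ℕ} (R R₁ R₂ : IntegralRep n), R₁.domain = R.domain → R₂.domain = R.domain → (∀ x ∈ R.domain, 0 < R₁.integrand x) → (∀ x ∈ R.domain, 0 < R₂.integrand x) → Set.EqOn R.integrand (R₁.integrand + R₂.integrand) R.domain → Nonempty (Shadow (of R - of R₁ - of R₂)) :=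
  fun R R₁ R₂ hd₁ hd₂ h₁ h₂ hsum => Shadow.of_integrandAdd_pos R R₁ R₂ hd₁ hd₂ h₁ h₂ hsum

end Summit.KontsevichZagierPeriods.KontsevichZagierPeriods.BetaCancellationDivisorSlicing

end
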